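import Literature.AlgebraicGeometry.Frobenioids.QuasiTemperoidConnected
import HarnessLib

/-!
# Frobenioids II, Example 1.3: `B^temp(Π)⁰` is connected, totally epimorphic and of FSM-type (proofs)

Mochizuki, *The geometry of Frobenioids II*, Kyushu J. Math. **62** (2008) 401–460, §1 Example 1.3
(ii)–(iii), author's text pp. 11–12 [cite: MochizukiFrdII2008, Ex 1.3 (iii) pp.11-12]. Example 1.3 (iii)
calls the categories `B^temp(Π)⁰`, `B^temp(Q)⁰`, `B^temp(G_F)⁰` through which its functor passes
"connected, totally epimorphic categories of FSM-type" (p. 12); the named fact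
`QuasiTemperoid.GaloisBaseFunctor` of `QuasiTemperoid.lean` records these three properties for
`B^temp(G_F)⁰`, `G_F = Gal(F̄/F)`. This proof-only file (no definitions) proves them for `B^temp(Π)⁰`
(`ConnectedPart (BTemp Π)`, the [FrdI] §0 connected objects of L3's `BTemp Π`) for an ARBITRARY
topological group `Π`, from the single-orbit description of `QuasiTemperoidConnected.lean`:

* every arrow of `B^temp(Π)⁰` is an epimorphism (it is surjective on points);
* every monomorphism of `B^temp(Π)⁰` is injective on points, hence bijective, hence an isomorphism —
  the printed "[indeed, every monomorphism of `E⁰` is an isomorphism]" of p. 11 — so `B^temp(Π)⁰` is of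
  FSM-type, hence of FSMFF-type ([FrdI] §0);
* `B^temp(Π)⁰` is a connected category (any two objects receive arrows from the orbit of a pair of
  points);

and specialises the first three to `Π = G_F = Field.absoluteGaloisGroup F` (any field `F`), which are
the three property conjuncts of `GaloisBaseFunctor F`. The analogous statements for the subcategories
`B^temp(Π, Π°)⁰` are the Ex. 1.3 (i) claims discharged by seat abc-iut-L6-t8 (`QuasiTemperoidProofs.lean`);
nothing here is re-proved from there. No statement of the paper is strengthened.
-/

open CategoryTheory CategoryTheory.Limits Topology
open Literature.AnabelianGeometry.SemiGraphs

namespace Literature.AlgebraicGeometry.Frobenioids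

namespace QuasiTemperoid

namespace BTempConnected

universe u

variable {G : Type u} [Group G] [TopologicalSpace G]

/-! ### Arrows of `B^temp(Π)⁰` are surjective; `B^temp(Π)⁰` is totally epimorphic -/

/-- An arrow of `B^temp(Π)⁰` is surjective on points. (FrdII Ex. 1.3, p. 11: the target is a single
orbit and the source has a point.) [cite: MochizukiFrdII2008, Ex 1.3 (iii) pp.11-12] -/
theorem connectedPart_hom_surjective {T₁ T₂ : ConnectedPart (BTemp G)} (f : T₁ ⟶ T₂) :
    Function.Surjective fun x : T₁.obj.obj.V => (f.hom.hom.hom x : T₂.obj.obj.V) := by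
  intro y
  obtain ⟨x₁⟩ := nonempty_of_isConnectedObj T₁.obj T₁.property
  exact surjective_of_isConnectedObj x₁ T₂.property f.hom y

/-- "`E⁰` is … totally epimorphic" for `E = B^temp(Π)` (FrdII Ex. 1.3, pp. 11–12): every arrow of
`B^temp(Π)⁰` is an epimorphism, being surjective on points. [cite: MochizukiFrdII2008, Ex 1.3 (iii) pp.11-12] -/
theorem connectedPart_isTotallyEpimorphic : IsTotallyEpimorphic (ConnectedPart (BTemp G)) := by
  refine ⟨fun {T₁ T₂} f => ⟨fun {T₃} g h hgh => ?_⟩⟩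
  apply ObjectProperty.hom_ext
  apply hom_ext_apply
  intro y
  obtain ⟨x, rfl⟩ := connectedPart_hom_surjective f y
  change ((f ≫ g).hom.hom.hom x : T₃.obj.obj.V) = (f ≫ h).hom.hom.hom x
  rw [hgh]

/-! ### Monomorphisms of `B^temp(Π)⁰` are isomorphisms; FSM-type -/

/-- A monomorphism of `B^temp(Π)⁰` is injective on points: two points with the same image are the two
projections of one point of the (connected) orbit of the pair, and the projections are equalised by the
monomorphism. [cite: MochizukiFrdII2008, Ex 1.3 (iii) pp.11-12] -/
theorem connectedPart_injective_of_mono {T₁ T₂ : ConnectedPart (BTemp G)} (f : T₁ ⟶ T₂) [Mono f] :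
    Function.Injective fun x : T₁.obj.obj.V => (f.hom.hom.hom x : T₂.obj.obj.V) := by
  intro x y hxy
  obtain ⟨T₀, x₀, p₁, p₂, hT₀, hp₁, hp₂⟩ := exists_connected_span T₁.obj T₁.obj x y
  let S₀ : ConnectedPart (BTemp G) := ⟨T₀, hT₀⟩
  let P₁ : S₀ ⟶ T₁ := ObjectProperty.homMk p₁
  let P₂ : S₀ ⟶ T₁ := ObjectProperty.homMk p₂
  have hP : P₁ ≫ f = P₂ ≫ f := by
    apply ObjectProperty.hom_ext
    apply hom_eq_of_apply_eq hT₀ _ _ x₀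
    change (f.hom.hom.hom (p₁.hom.hom x₀) : T₂.obj.obj.V) = f.hom.hom.hom (p₂.hom.hom x₀)
    rw [hp₁, hp₂]
    exact hxy
  have hP' : P₁ = P₂ := (cancel_mono f).mp hP
  have : (P₁.hom.hom.hom x₀ : T₁.obj.obj.V) = P₂.hom.hom.hom x₀ := by rw [hP']
  change (p₁.hom.hom x₀ : T₁.obj.obj.V) = p₂.hom.hom x₀ at this
  rwa [hp₁, hp₂] at this

/-- A morphism of `B^temp(Π)` that is bijective on points is an isomorphism (the inverse map is
equivariant). [cite: MochizukiFrdII2008, Ex 1.3 (iii) pp.11-12] -/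
theorem isIso_of_bijective {T₁ T₂ : BTemp G} (f : T₁ ⟶ T₂)
    (hf : Function.Bijective fun x : T₁.obj.V => (f.hom.hom x : T₂.obj.V)) : IsIso f := by
  let e : T₁.obj.V ≃ T₂.obj.V := Equiv.ofBijective _ hf
  have he : ∀ x, e x = (f.hom.hom x : T₂.obj.V) := fun _ => rfl
  let g : T₂ ⟶ T₁ := ObjectProperty.homMk
    { hom := TypeCat.ofHom e.symm
      comm := fun a => by
        apply ConcreteCategory.hom_ext
        intro y
        change e.symm (T₂.obj.ρ a y) = T₁.obj.ρ a (e.symm y)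
        apply e.injective
        rw [Equiv.apply_symm_apply, he, hom_ρ, ← he, Equiv.apply_symm_apply] }
  refine ⟨g, hom_ext_apply fun x => ?_, hom_ext_apply fun y => ?_⟩
  · change e.symm (f.hom.hom x) = x
    rw [← he, Equiv.symm_apply_apply]
  · change (f.hom.hom (e.symm y) : T₂.obj.V) = y
    rw [← he, Equiv.apply_symm_apply]

/-- "[Indeed, every monomorphism of `E⁰` is an isomorphism]" for `E = B^temp(Π)` (FrdII Ex. 1.3, p. 11):
a monomorphism of `B^temp(Π)⁰` is injective and surjective on points, hence an isomorphism.
[cite: MochizukiFrdII2008, Ex 1.3 (iii) pp.11-12] -/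
theorem connectedPart_isIso_of_mono {T₁ T₂ : ConnectedPart (BTemp G)} (f : T₁ ⟶ T₂) [Mono f] :
    IsIso f := by
  haveI : IsIso f.hom :=
    isIso_of_bijective f.hom ⟨connectedPart_injective_of_mono f, connectedPart_hom_surjective f⟩
  exact (ObjectProperty.isIso_hom_iff f).mp inferInstance

/-- "`E⁰` is … of FSM-type" for `E = B^temp(Π)` (FrdII Ex. 1.3, pp. 11–12): every FSM-morphism of
`B^temp(Π)⁰` is an isomorphism. [cite: MochizukiFrdII2008, Ex 1.3 (iii) pp.11-12] -/
theorem connectedPart_isOfFSMType : IsOfFSMType (ConnectedPart (BTemp G)) :=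
  isOfFSMType_of_mono_isIso fun f hf => by
    haveI := hf
    exact connectedPart_isIso_of_mono f

/-- "hence, in particular, of FSMFF-type" for `E = B^temp(Π)` (FrdII Ex. 1.3, p. 11; [FrdI] §0).
[cite: MochizukiFrdII2008, Ex 1.3 (iii) pp.11-12] -/
theorem connectedPart_isOfFSMFFType : IsOfFSMFFType (ConnectedPart (BTemp G)) :=
  connectedPart_isOfFSMType.isOfFSMFFType

/-! ### `B^temp(Π)⁰` is a connected category -/

/-- The one-point `Π`-set is a connected object of `B^temp(Π)`, so `B^temp(Π)⁰` is nonempty.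
[cite: MochizukiFrdII2008, Ex 1.3 (iii) pp.11-12] -/
theorem connectedPart_nonempty : Nonempty (ConnectedPart (BTemp G)) := by
  let P : BTemp G := ⟨{ V := PUnit.{u + 1}, ρ := 1 }, ⟨inferInstance, fun _ => by
    have : {g : G | (1 : G →* End PUnit.{u + 1}) g PUnit.unit = PUnit.unit} = Set.univ :=
      Set.eq_univ_of_forall fun _ => rfl
    rw [this]
    exact isOpen_univ⟩⟩
  exact ⟨⟨P, isConnectedObj_of_transitive P PUnit.unit fun _ => ⟨1, rfl⟩⟩⟩

/-- "`E⁰` is connected" for `E = B^temp(Π)` (FrdII Ex. 1.3, pp. 11–12): any two objects of `B^temp(Π)⁰`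
receive arrows from a third (the orbit of a pair of points), so the category is connected.
[cite: MochizukiFrdII2008, Ex 1.3 (iii) pp.11-12] -/
theorem connectedPart_isConnected : IsConnected (ConnectedPart (BTemp G)) := by
  haveI := (connectedPart_nonempty : Nonempty (ConnectedPart (BTemp G)))
  refine zigzag_isConnected fun T₁ T₂ => ?_
  obtain ⟨x₁⟩ := nonempty_of_isConnectedObj T₁.obj T₁.property
  obtain ⟨x₂⟩ := nonempty_of_isConnectedObj T₂.obj T₂.property
  obtain ⟨T₀, _, p₁, p₂, hT₀, -, -⟩ := exists_connected_span T₁.obj T₂.obj x₁ x₂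
  let S₀ : ConnectedPart (BTemp G) := ⟨T₀, hT₀⟩
  exact Zigzag.of_inv_hom (ObjectProperty.homMk p₁ : S₀ ⟶ T₁) (ObjectProperty.homMk p₂ : S₀ ⟶ T₂)

/-! ### Example 1.3 (iii): the three printed properties of `B^temp(G_F)⁰` -/

section Galois

variable (F : Type u) [Field F]

/-- FrdII Ex. 1.3 (iii), p. 12: `B^temp(G_F)⁰` is a connected category, `G_F = Gal(F̄/F)` the absolute
Galois group of a field `F` (`Field.absoluteGaloisGroup F` with its Krull topology).
[cite: MochizukiFrdII2008, Ex 1.3 (iii) pp.11-12] -/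
theorem galoisBase_isConnected : IsConnected (ConnectedPart (BTemp (Field.absoluteGaloisGroup F))) :=
  connectedPart_isConnected

/-- FrdII Ex. 1.3 (iii), p. 12: `B^temp(G_F)⁰` is totally epimorphic. [cite: MochizukiFrdII2008, Ex 1.3 (iii) pp.11-12] -/
theorem galoisBase_isTotallyEpimorphic :
    IsTotallyEpimorphic (ConnectedPart (BTemp (Field.absoluteGaloisGroup F))) :=
  connectedPart_isTotallyEpimorphic

/-- FrdII Ex. 1.3 (iii), p. 12: `B^temp(G_F)⁰` is of FSM-type. [cite: MochizukiFrdII2008, Ex 1.3 (iii) pp.11-12] -/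
theorem galoisBase_isOfFSMType : IsOfFSMType (ConnectedPart (BTemp (Field.absoluteGaloisGroup F))) :=
  connectedPart_isOfFSMType

end Galois

end BTempConnected

end QuasiTemperoid

end Literature.AlgebraicGeometry.Frobenioids
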